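import Summits.HodgeConjecture.HodgeConjecture.Theorems.NikulinTwinTransportRealMultiplicationCanonicalClass
import Summits.HodgeConjecture.HodgeConjecture.Theorems.NikulinTwinTransportTwinSimilitudeAlgebraicMarkings
import Summits.HodgeConjecture.HodgeConjecture.Theses.NikulinTwinTransport
import Literature.AlgebraicGeometry.Surfaces.K3HodgeTypesHolds
import Literature.AlgebraicGeometry.HodgeTheory.GysinBaseChange
import Literature.AlgebraicGeometry.HodgeTheory.CupPreservesHodgeTypeOfDeRham
import Literature.AlgebraicGeometry.HodgeTheory.ComplexConjugationHolds
import Literature.AlgebraicGeometry.HodgeTheory.HodgeConjecture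
import Literature.NumberTheory.Transcendental.DeRhamTheoremMultiplicative

/-!
# Route NikulinTwinTransport · `RealMultiplicationSqrtTwoAlgebraic` (stmt-HodgeConjecture-13679) —
# the item is implied by the Hodge conjecture (converse of the Künneth criterion)

The route item `RealMultiplicationSqrtTwoAlgebraic` (real multiplication by `√2` on the transcendental
lattice of a projective K3 surface `S` is induced by an algebraic class on `S × S`) is an OPEN
sub-case of the Hodge conjecture; the sibling files reduce it to the crux X = `TwinSimilitudeAlgebraic`
(`realMultiplicationSqrtTwoAlgebraic_of_twinSimilitude_of_b2`: X + `b₂ = 22`). This file kernel-checks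
the bound from the OTHER side, on the tree's carriers: the item FOLLOWS from the Hodge conjecture for
the smooth projective fourfold `S ⊗ S` — so the rendering is a genuine sub-case of the summit, and a
refutation of the item would refute the Hodge conjecture itself. With the canonical class `Υ_G` of the
sibling file `NikulinTwinTransportRealMultiplicationCanonicalClass` (rational, of type `(2,2)`, acting as
`c₀ • G`):

* `hodgeEndomorphism_induced_of_hodgeConjectureFor_square` — granted `HodgeConjectureFor 4 (S ⊗ S)`,
  every rational Hodge endomorphism `G` of `H²(S(ℂ); ℂ)` of a marked projective K3 surface is induced
  by an ALGEBRAIC class of codimension `2` on `S ⊗ S` (`Υ_G` is algebraic by HC, `c₀⁻¹ • Υ_G`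
  induces `G`); inputs beyond HC are THEOREMS of the tree: the K3 Hodge types of `H²`
  (`Huybrechts_K3_hodgeTypes_H2_holds`), reality of markings (`conjClass_marking_symm`), the
  bigrading of `∪` from de Rham's theorem (`cupPreservesHodgeType_of_nonempty_hodgeModel`,
  `nonempty_hodgeModel_holds`, `exists_deRhamIsoFamily_holds`), Künneth spanning
  (`kunnethSpan_complexBetti`) for the fibre integral, Poincaré duality;
* `hodgeEndomorphisms_induced_of_hodgeConjectureFor_square` — the same for every projective K3 surface
  (`IsK3Surface` unfolded as in the route), granted the marking fact `Huybrechts_K3_marking_exists`: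
  VERBATIM the antecedent of the Künneth criterion (K) of `squareGlue_of_kunnethCriterion`, now
  derived from HC(`S ⊗ S`) (Varesco: "HC for `X²` ⟺ every element of `End_Hdg(T(X))` is algebraic",
  the direction ⟹);
* `realMultiplicationSqrtTwoAlgebraic_of_hodgeConjectureFor_squares`,
  `realMultiplicationSqrtTwoAlgebraic_of_hodgeConjecture` — THE ROUTE DECL BY NAME from the Hodge
  conjecture (for the squares of projective K3 surfaces, resp. the summit statement) and
  `Huybrechts_K3_marking_exists`. Of the item's hypotheses on `e` only rationality and type
  preservation are used on this side;
* `realMultiplication_algebraic_of_squareHodgeOfSqrtTwo` — on the `√2`-sector the crux binder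
  `SquareHodgeOfSqrtTwo` (stmt-HodgeConjecture-13680) returns the deliverable at `S` (so, with
  `squareHodgeOfSqrtTwo_of_kunneth`, binder and deliverable are equivalent on the sector modulo
  Lefschetz `(1,1)`, markings and the standard inputs).

So `HodgeConjecture → RealMultiplicationSqrtTwoAlgebraic` (mod markings) and
`TwinSimilitudeAlgebraic → RealMultiplicationSqrtTwoAlgebraic` (mod `b₂ = 22`): the item sits between
the crux X and the summit. Prover seat prover-pitem-stmt-HodgeConjecture-13679-c7-0.

## References

* [Varesco2023] M. Varesco, Hodge similitudes and the Hodge conjecture for squares of K3 surfaces,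
  Math. Z. 305 (2023), §2 (p. 8), Rem. 2.2.
* [VoisinHodgeI2002] C. Voisin, Hodge Theory and Complex Algebraic Geometry I, CUP 2002, §11.3.3
  Lemma 11.41.
* [Huybrechts2016K3] D. Huybrechts, Lectures on K3 Surfaces, CUP 2016, Ch. 1 Prop. 3.5, Ch. 6 Prop. 1.2.
* [Deligne2000] P. Deligne, The Hodge conjecture, Clay 2000, §1.
-/

noncomputable section

open scoped Manifold
open CategoryTheory AlgebraicGeometry MonoidalCategory CartesianMonoidalCategory
open Literature.AlgebraicGeometry.Motives Literature.AlgebraicGeometry.HodgeTheory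
open Literature.AlgebraicGeometry.Surfaces
open Literature.AlgebraicTopology.SingularHomology

namespace Summit.HodgeConjecture.HodgeConjecture.Theorems.NikulinTwinTransport

/-! ### Hodge endomorphisms of `H²(K3)` are algebraic under HC(`S ⊗ S`); the route decl from HC -/

/-- **Under the Hodge conjecture for `S ⊗ S`, every rational Hodge endomorphism of `H²(S(ℂ); ℂ)` of a
projective K3 surface is induced by an algebraic class of codimension `2` on `S ⊗ S`** — the converse
half of "HC for `X²` ⟺ every element of `End_Hdg(T(X))` is algebraic" on the tree's carriers, for a
marked K3 surface (`η`, generator `p₀` of `H⁴`, period `x₀`: the clauses of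
`Huybrechts_K3_marking_exists`). Proof: `Υ_G` is rational (`isRationalClass_sum_cross`) and `(2,2)`
(`isOfHodgeType_sum_cross_K3`, with the K3 Hodge types `Huybrechts_K3_hodgeTypes_H2_holds`, the reality
of markings `conjClass_marking_symm`, and `CupPreservesHodgeType` from de Rham's theorem), hence
algebraic by `HodgeConjectureFor 4 (S ⊗ S)`; and `c₀⁻¹ • Υ_G` induces `G` (`corr_sum_cross`, fibre
integration from the Künneth theorem `kunnethSpan_complexBetti`). [cite: Varesco2023, §2 (p. 8)]
[cite: VoisinHodgeI2002, §11.3.3 Lemma 11.41] [cite: Huybrechts2016K3, Ch. 6 Prop. 1.2] -/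
theorem hodgeEndomorphism_induced_of_hodgeConjectureFor_square (μ : OrientationFamily)
    {S : SchemeOver ℂ} (hK3 : IsK3Surface S)
    (η : complexBetti S (2 * 1) ≃ₗ[ℂ] (K3Index → ℂ)) (p₀ : complexBetti S (2 * 2)) (x₀ : K3Index → ℂ)
    (hp₀ : p₀ ≠ 0)
    (hint : ∀ c : complexBetti S (2 * 1), IsIntegralClass c ↔ ∃ v : K3Index → ℤ, η c = fun i => (v i : ℂ))
    (hcup : ∀ a b : complexBetti S (2 * 1),
      cupProduct (rfl : 2 * 1 + 2 * 1 = 2 * 2) a b = k3Form (η a) (η b) • p₀)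
    (h20 : IsOfHodgeType 2 S (2 * 1) 2 0 (η.symm x₀))
    (hxx : k3Form x₀ x₀ = 0) (hxpos : 0 < (k3Form (star x₀) x₀).re)
    (hHC : HodgeConjectureFor 4 (S ⊗ S))
    (G : complexBetti S (2 * 1) →ₗ[ℂ] complexBetti S (2 * 1))
    (hG_rat : ∀ x, IsRationalClass x → IsRationalClass (G x))
    (hG_typ : ∀ (i j : ℕ) x, IsOfHodgeType 2 S (2 * 1) i j x → IsOfHodgeType 2 S (2 * 1) i j (G x)) :
    ∃ γ ∈ algebraicClasses (S ⊗ S) 2, ∀ x : complexBetti S (2 * 1),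
      G x = complexGysin μ (IsSmoothProjective.tensor_holds hK3.isSmoothProjective hK3.isSmoothProjective)
        hK3.isSmoothProjective (fst S S) (rfl : 2 * 1 + 2 * 2 + 2 * 2 = 2 * 1 + 2 * (2 + 2))
        (cupProduct (rfl : 2 * 1 + 2 * 2 = 2 * 1 + 2 * 2) (complexBetti.map (snd S S) (2 * 1) x) γ) := by
  have hS := hK3.isSmoothProjective
  have hP : IsSmoothProjective 4 (S ⊗ S) := IsSmoothProjective.tensor_holds hS hS
  obtain ⟨⟨M⟩, hHC⟩ := hHC
  have hcupP : CupPreservesHodgeType 4 (S ⊗ S) :=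
    cupPreservesHodgeType_of_nonempty_hodgeModel hodgePQ_independent_of_hodgeModel_holds
      nonempty_hodgeModel_holds
      (fun E _ _ _ ↦ Literature.NumberTheory.Transcendental.exists_deRhamIsoFamily_holds (E := E)) hP
  -- the period: `σ = η⁻¹ x₀ ≠ 0`, `σ̄ = η⁻¹ x̄₀`, `(x₀.x̄₀) ≠ 0`
  have hx0 : x₀ ≠ 0 := by
    rintro rfl
    simp [k3Form] at hxpos
  have hσ0 : η.symm x₀ ≠ 0 := fun h ↦ hx0 (by simpa using congrArg η h)
  have hs : k3Form x₀ (star x₀) ≠ 0 := fun h ↦ by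
    rw [k3Form_comm] at h
    rw [h, Complex.zero_re] at hxpos
    exact lt_irrefl _ hxpos
  have hconj : conjClass (ComplexPoints S) (2 * 1) (η.symm x₀) = η.symm (star x₀) :=
    conjClass_marking_symm η hint x₀
  -- the K3 Hodge types of `H²`
  obtain ⟨-, h2, h3⟩ := Huybrechts_K3_hodgeTypes_H2_holds S hK3 (η.symm x₀) h20 hσ0
  have h02 : IsOfHodgeType 2 S (2 * 1) 0 2 (η.symm (star x₀)) := by
    rw [← hconj]
    exact (h2 _).2 ⟨1, (one_smul _ _).symm⟩
  have h11 : ∀ c : complexBetti S (2 * 1), k3Form (η c) x₀ = 0 → k3Form (η c) (star x₀) = 0 →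
      IsOfHodgeType 2 S (2 * 1) 1 1 c := fun c ha hb ↦
    (h3 c).2 ⟨by rw [hcup, LinearEquiv.apply_symm_apply, ha, zero_smul],
      by rw [hconj, hcup, LinearEquiv.apply_symm_apply, hb, zero_smul]⟩
  -- the canonical class is rational and `(2,2)`, hence algebraic
  have htype := isOfHodgeType_sum_cross_K3 η hS M hcupP x₀ hxx hs h20 h02 h11 G hG_typ
  have hrat := isRationalClass_sum_cross η hint G hG_rat
  have halg := hHC 2 _ hrat htype
  -- fibre integration and the action
  obtain ⟨c₀, hc₀, hFI⟩ :=
    fibreIntegral_square_of_kunneth μ hS (kunnethSpan_complexBetti hS hS (2 * (2 + 2))) hp₀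
  refine ⟨c₀⁻¹ • _, Submodule.smul_mem _ _ halg, fun x ↦ ?_⟩
  rw [map_smul, map_smul, corr_sum_cross η μ hS hcup hFI G x, smul_smul, inv_mul_cancel₀ hc₀, one_smul]

/-- **The antecedent of the Künneth criterion (K) from HC(`S ⊗ S`)**: for every projective K3
surface `S` (`IsK3Surface`, unfolded as in the route) with `HodgeConjectureFor 4 (S ⊗ S)`, every
rational type-preserving endomorphism of `H²(S(ℂ); ℂ)` is induced by an algebraic class of codimension
`2` on `S ⊗ S` — verbatim the inner hypothesis of `squareGlue_of_kunnethCriterion`, granted markings.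
[cite: Varesco2023, §2 (p. 8)] -/
theorem hodgeEndomorphisms_induced_of_hodgeConjectureFor_square (hmark : Huybrechts_K3_marking_exists)
    (μ : OrientationFamily) (S : SchemeOver ℂ)
    (hS : IsSmoothProjective 2 S ∧ Subsingleton (structureSheafCohomology S.left 1) ∧
      ∃ (A : HodgeModel 2 S) (η : Literature.Geometry.Kaehler.MForm 𝓘(ℝ, A.model) A.carrier ℂ 2),
        Literature.Geometry.Kaehler.IsHolomorphicInCharts η ∧ ∀ x, η x ≠ 0)
    (hHC : HodgeConjectureFor 4 (S ⊗ S))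
    (G : complexBetti S (2 * 1) →ₗ[ℂ] complexBetti S (2 * 1))
    (hG_rat : ∀ x, IsRationalClass x → IsRationalClass (G x))
    (hG_typ : ∀ (i j : ℕ) x, IsOfHodgeType 2 S (2 * 1) i j x → IsOfHodgeType 2 S (2 * 1) i j (G x)) :
    ∃ γ ∈ algebraicClasses (S ⊗ S) 2, ∀ x : complexBetti S (2 * 1),
      G x = complexGysin μ (IsSmoothProjective.tensor_holds hS.1 hS.1) hS.1 (fst S S)
        (rfl : 2 * 1 + 2 * 2 + 2 * 2 = 2 * 1 + 2 * (2 + 2))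
        (cupProduct (rfl : 2 * 1 + 2 * 2 = 2 * 1 + 2 * 2) (complexBetti.map (snd S S) (2 * 1) x) γ) := by
  have hK3 : IsK3Surface S := hS
  obtain ⟨η, p₀, x₀, hp₀, ⟨-, -, hint, hcup, h20, -⟩, ⟨hxx, hxpos, -⟩⟩ := hmark.elim hK3
  exact hodgeEndomorphism_induced_of_hodgeConjectureFor_square μ hK3 η p₀ x₀ hp₀ hint hcup h20 hxx hxpos
    hHC G hG_rat hG_typ

/-- **`RealMultiplicationSqrtTwoAlgebraic` (stmt-HodgeConjecture-13679) from the Hodge conjecture for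
squares of K3 surfaces** and the marking fact: the route decl BY NAME. Of the item's hypotheses on `e`
only rationality and type preservation are used (self-adjointness, `e|_{NS} = 0`, `e² = 2` on `NS^⊥`
are idle on this side of the sandwich `HC → item ← X`). [cite: Varesco2023, §2 (p. 8) and Rem. 2.2]
[cite: Deligne2000, §1] -/
theorem realMultiplicationSqrtTwoAlgebraic_of_hodgeConjectureFor_squares
    (hHC : ∀ S : SchemeOver ℂ, IsK3Surface S → HodgeConjectureFor 4 (S ⊗ S))
    (hmark : Huybrechts_K3_marking_exists) :
    Theses.NikulinTwinTransport.RealMultiplicationSqrtTwoAlgebraic := by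
  intro μ _ S hS e he_rat he_typ _ _ _
  exact hodgeEndomorphisms_induced_of_hodgeConjectureFor_square hmark μ S hS (hHC S hS) e he_rat he_typ

/-- **`RealMultiplicationSqrtTwoAlgebraic` (stmt-HodgeConjecture-13679) from the Hodge conjecture** (the
summit statement `HodgeConjecture`, applied to the smooth projective fourfolds `S ⊗ S`) and the marking
fact `Huybrechts_K3_marking_exists`: the item is a correctly rendered sub-case of the summit — a
refutation of it refutes the Hodge conjecture. [cite: Deligne2000, §1] [cite: Varesco2023, §2 (p. 8)] -/
theorem realMultiplicationSqrtTwoAlgebraic_of_hodgeConjecture (hHC : _root_.HodgeConjecture)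
    (hmark : Huybrechts_K3_marking_exists) :
    Theses.NikulinTwinTransport.RealMultiplicationSqrtTwoAlgebraic :=
  realMultiplicationSqrtTwoAlgebraic_of_hodgeConjectureFor_squares
    (fun _ hS ↦ hHC (IsSmoothProjective.tensor_holds hS.isSmoothProjective hS.isSmoothProjective)) hmark

/-- **On the sector, the binder `SquareHodgeOfSqrtTwo` returns the deliverable.** For a projective K3
surface `S` on the `√2`-sector (the hypotheses of the crux `SquareHodgeOfSqrtTwo`, stmt-HodgeConjecture-13680,
verbatim: `e` rational, type-preserving, cup-self-adjoint, `e|_{NS} = 0`, `e² = 2` on `NS^⊥`, and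
`End_Hdg(NS^⊥) ⊆ ℚ + ℚ·e`), `SquareHodgeOfSqrtTwo` gives `HodgeConjectureFor 4 (S ⊗ S)`, hence (by
`hodgeEndomorphisms_induced_of_hodgeConjectureFor_square`, granted markings) the class of `e` is
algebraic — the conclusion of `RealMultiplicationSqrtTwoAlgebraic` at `S`. With
`squareHodgeOfSqrtTwo_of_kunneth` (deliverable + Lefschetz `(1,1)` ⟹ sector) the binder `h₁` of the
route's deciding theorem is thus equivalent, on the sector and modulo Lefschetz `(1,1)` / markings / the
standard inputs, to the deliverable itself. [cite: Varesco2023, §2 (p. 8)] -/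
theorem realMultiplication_algebraic_of_squareHodgeOfSqrtTwo
    (hSq : Theses.NikulinTwinTransport.SquareHodgeOfSqrtTwo) (hmark : Huybrechts_K3_marking_exists)
    (μ : OrientationFamily) (S : SchemeOver ℂ)
    (hS : IsSmoothProjective 2 S ∧ Subsingleton (structureSheafCohomology S.left 1) ∧
      ∃ (A : HodgeModel 2 S) (η : Literature.Geometry.Kaehler.MForm 𝓘(ℝ, A.model) A.carrier ℂ 2),
        Literature.Geometry.Kaehler.IsHolomorphicInCharts η ∧ ∀ x, η x ≠ 0)
    (e : complexBetti S (2 * 1) →ₗ[ℂ] complexBetti S (2 * 1))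
    (he_rat : ∀ x, IsRationalClass x → IsRationalClass (e x))
    (he_typ : ∀ (i j : ℕ) x, IsOfHodgeType 2 S (2 * 1) i j x → IsOfHodgeType 2 S (2 * 1) i j (e x))
    (he_adj : ∀ x y : complexBetti S (2 * 1),
      cupProduct (rfl : 2 * 1 + 2 * 1 = 2 * 2) (e x) y = cupProduct (rfl : 2 * 1 + 2 * 1 = 2 * 2) x (e y))
    (he_N : ∀ d ∈ algebraicClasses S 1, e d = 0)
    (he_T : ∀ x : complexBetti S (2 * 1),
      (∀ d ∈ algebraicClasses S 1, cupProduct (rfl : 2 * 1 + 2 * 1 = 2 * 2) x d = 0) → e (e x) = (2 : ℂ) • x)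
    (hEnd : ∀ (f : complexBetti S (2 * 1) →ₗ[ℂ] complexBetti S (2 * 1)),
      (∀ x, IsRationalClass x → IsRationalClass (f x)) →
      (∀ (i j : ℕ) x, IsOfHodgeType 2 S (2 * 1) i j x → IsOfHodgeType 2 S (2 * 1) i j (f x)) →
      (∀ d ∈ algebraicClasses S 1, f d = 0) →
      (∀ x : complexBetti S (2 * 1), ∀ d ∈ algebraicClasses S 1,
        cupProduct (rfl : 2 * 1 + 2 * 1 = 2 * 2) (f x) d = 0) →
      ∃ a b : ℚ, ∀ x : complexBetti S (2 * 1),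
        (∀ d ∈ algebraicClasses S 1, cupProduct (rfl : 2 * 1 + 2 * 1 = 2 * 2) x d = 0) →
        f x = (a : ℂ) • x + (b : ℂ) • e x) :
    ∃ γ ∈ algebraicClasses (S ⊗ S) 2, ∀ x : complexBetti S (2 * 1),
      e x = complexGysin μ (IsSmoothProjective.tensor_holds hS.1 hS.1) hS.1 (fst S S)
        (rfl : 2 * 1 + 2 * 2 + 2 * 2 = 2 * 1 + 2 * (2 + 2))
        (cupProduct (rfl : 2 * 1 + 2 * 2 = 2 * 1 + 2 * 2) (complexBetti.map (snd S S) (2 * 1) x) γ) :=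
  hodgeEndomorphisms_induced_of_hodgeConjectureFor_square hmark μ S hS
    (hSq S hS e he_rat he_typ he_adj he_N he_T hEnd) e he_rat he_typ

end Summit.HodgeConjecture.HodgeConjecture.Theorems.NikulinTwinTransport

end
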